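import Summits.Ventures.YMGap.RobustBall.ShapeLoopFamilyFR
import Summits.Ventures.YMGap.RobustBall.RowsSWindows
import Summits.Ventures.YMGap.RobustBall.RectangleEdges
import HarnessLib

/-!
# Venture YMGap, track ROBUST-BALL (tier 1) — the `1 × 2`-RECTANGLE (Symanzik-type) improved action on `ℤ^d` as a named
# member: mass gap for all `0 ≤ β_W ≤ 1/8` and `|c₁| ≤ 1/3100` (`SU(2)`, `d = 4`)

HONEST FRAMING. WHAT THIS IS: a venture file (cell `pub-ymgap`, track Y2 ROBUST-BALL, seat rb-p1), a NAMED instance of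
`ShapeLoopFamilyFR.lean`: the shape family of all `1 × 2` and `2 × 1` rectangles in all coordinate planes (`rect12Shape`, `2·C(d,2)`
shapes of length `6`, extent `≤ 3`), translated everywhere with one common coupling `c₁` — the perturbation
`c₁ ∑_{1×2 rectangles} Re tr U_∂ / N` of the Wilson action familiar from tree-level improved actions (here as a strong-coupling
perturbation, no improvement claim). Plain norm `= 2·C(d,2)·36·|c₁|` (`= 432|c₁|` for `d = 4`). Cells: `SU(2)`, `d = 4`, EVERY
`0 ≤ β_W ≤ 1/8` and `|c₁| ≤ 1/3100` ⇒ unique DLR state with exponential clustering (`su2_rect12Action_massGapS_window_1_8`); every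
`SU(N)`, `N ≥ 2`, 't Hooft `|β| ≤ 1/64`, `|c₁| ≤ 1/4000` (`suN_rect12Action_massGapS_1_64`). WHAT IT IS NOT: strong-coupling lattice
statements; nothing about Symanzik improvement, the continuum limit or the Clay problem.

References: this track's `ShapeLoopFamilyFR.lean`, `RowsSWindows.lean`, `RectangleEdges.lean`; M. Lüscher, P. Weisz, Commun. Math. Phys.
97 (1985) 59 (the `1 × 2` rectangle term of improved lattice actions — context only).
-/

noncomputable section

open MeasureTheory Function Real SimpleGraph
open Literature.Probability.LatticeModels
open Literature.MathematicalPhysics.QuantumLattice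
open Literature.MathematicalPhysics.QuantumFieldTheory (walkEdges)

namespace Summit.Ventures.YMGap.RobustBall

variable {d : ℕ}

/-! ### The `1 × 2` rectangle shapes -/

variable (d) in
/-- Index of the `1 × 2` rectangle shapes: a coordinate plane `a < b` and an orientation flag (`true`: `1` step along `a`, `2` along
`b`; `false`: `2` along `a`, `1` along `b`). -/
abbrev Rect12Idx : Type := {p : Fin d × Fin d // p.1 < p.2} × Bool

/-- **The `1 × 2` rectangle shapes** based at the origin. -/
def rect12Shape (s : Rect12Idx d) : (zdGraph d).Walk (0 : Site d) 0 :=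
  rectWalk 0 s.1.1.1 s.1.1.2 (if s.2 then 1 else 2) (if s.2 then 2 else 1)

/-- Every `1 × 2` rectangle shape has length `6`. -/
theorem length_rect12Shape (s : Rect12Idx d) : (rect12Shape s).length = 6 := by
  unfold rect12Shape
  rw [length_rectWalk]
  cases s.2 <;> rfl

/-- The shapes are nontrivial. -/
theorem length_rect12Shape_pos (s : Rect12Idx d) : 0 < (rect12Shape s).length := by
  rw [length_rect12Shape]; norm_num

/-- Links of a `1 × 2` rectangle shape are within `ℓ^∞`-distance `3`. -/
theorem norm_sub_le_rect12Shape (s : Rect12Idx d) :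
    ∀ e ∈ walkEdges (rect12Shape s), ∀ y ∈ walkEdges (rect12Shape s), ‖e.1 - y.1‖ ≤ (3 : ℝ) := by
  intro e he y hy
  have h := norm_sub_le_of_mem_walkEdges_rectWalk (x := (0 : Site d)) (i := s.1.1.1) (j := s.1.1.2)
    (R := if s.2 then 1 else 2) (T := if s.2 then 2 else 1) he hy
  refine h.trans ?_
  cases s.2 <;> norm_num

/-- **The plain norm of the `1 × 2` family**: `∑_s |c₁| · |s|² = 2·C(d,2)·36·|c₁|`. -/
theorem sum_rect12Shape_norm (c₁ : ℝ) :
    ∑ s : Rect12Idx d, |c₁| * ((rect12Shape s).length : ℝ) ^ 2 =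
      (2 * Fintype.card {p : Fin d × Fin d // p.1 < p.2} : ℕ) * (36 * |c₁|) := by
  simp only [length_rect12Shape, Nat.cast_ofNat]
  rw [Finset.sum_const, Finset.card_univ, nsmul_eq_mul, Fintype.card_prod, Fintype.card_bool]
  push_cast
  ring

/-! ### Cells -/

/-- **`SU(2)`, `d = 4`, EVERY `0 ≤ β_W ≤ 1/8`, `|c₁| ≤ 1/3100`**: the Wilson action plus `c₁ ∑_{1×2 rectangles} Re tr U_∂/2` has a unique
DLR state with exponential clustering (`432·|c₁| ≤ 0.1394 ≤ 0.143`; tier-1 window row `su2_windowB_1_8` at range `3`). -/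
theorem su2_rect12Action_massGapS_window_1_8 {βW c₁ : ℝ} (hβ0 : 0 ≤ βW) (hβ : βW ≤ 1 / 8) (hc : |c₁| ≤ 1 / 3100) :
    PerturbedMassGapAtS 4 2 (βW / 4) (loopFamilyAction (d := 4) 2 (shapeLoop rect12Shape) fun _ => c₁) := by
  have hP : Fintype.card {p : Fin 4 × Fin 4 // p.1 < p.2} = 6 := by decide
  have hε : ∑ s : Rect12Idx 4, |c₁| * ((rect12Shape s).length : ℝ) ^ 2 ≤ 143 / 1000 := by
    rw [sum_rect12Shape_norm, hP]; push_cast; nlinarith [abs_nonneg c₁]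
  exact perturbedMassGapAtS_shapeLoop_of_tier1 (c₀ := fun _ => c₁) (su2_windowB_1_8 hβ0 hβ (3 : ℕ)) length_rect12Shape_pos
    (fun s => by exact_mod_cast norm_sub_le_rect12Shape s) hε

/-- **`SU(2)`, `d = 4`, EVERY `0 ≤ β_W ≤ 1/10`, `|c₁| ≤ 1/2100`**: radius `0.209` (window row `su2_windowB_1_10`). -/
theorem su2_rect12Action_massGapS_window_1_10 {βW c₁ : ℝ} (hβ0 : 0 ≤ βW) (hβ : βW ≤ 1 / 10) (hc : |c₁| ≤ 1 / 2100) :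
    PerturbedMassGapAtS 4 2 (βW / 4) (loopFamilyAction (d := 4) 2 (shapeLoop rect12Shape) fun _ => c₁) := by
  have hP : Fintype.card {p : Fin 4 × Fin 4 // p.1 < p.2} = 6 := by decide
  have hε : ∑ s : Rect12Idx 4, |c₁| * ((rect12Shape s).length : ℝ) ^ 2 ≤ 209 / 1000 := by
    rw [sum_rect12Shape_norm, hP]; push_cast; nlinarith [abs_nonneg c₁]
  exact perturbedMassGapAtS_shapeLoop_of_tier1 (c₀ := fun _ => c₁) (su2_windowB_1_10 hβ0 hβ (3 : ℕ)) length_rect12Shape_pos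
    (fun s => by exact_mod_cast norm_sub_le_rect12Shape s) hε

/-- **Every `N ≥ 2`, `d = 4`, 't Hooft `|β| ≤ 1/64`, `|c₁| ≤ 1/4000`**: the `1 × 2`-rectangle action has the mass gap, `N`-uniformly. -/
theorem suN_rect12Action_massGapS_1_64 {N : ℕ} (hN : 2 ≤ N) {β c₁ : ℝ} (hβ : |β| ≤ 1 / 64) (hc : |c₁| ≤ 1 / 4000) :
    PerturbedMassGapAtS 4 N β (loopFamilyAction (d := 4) N (shapeLoop rect12Shape) fun _ => c₁) := by
  have hP : Fintype.card {p : Fin 4 × Fin 4 // p.1 < p.2} = 6 := by decide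
  have hε : ∑ s : Rect12Idx 4, |c₁| * ((rect12Shape s).length : ℝ) ^ 2 ≤ 11 / 100 := by
    rw [sum_rect12Shape_norm, hP]; push_cast; nlinarith [abs_nonneg c₁]
  exact suN_finiteShapes_massGapS_1_64 (c₀ := fun _ => c₁) hN hβ (R := ((3 : ℕ) : ℝ)) length_rect12Shape_pos
    (fun s => by exact_mod_cast norm_sub_le_rect12Shape s) hε

/-- **`SU(2)`, `d = 3`, `β_W = 1/5`, `|c₁| ≤ 1/1800`**: the `1 × 2`-rectangle action on `ℤ³` (`216·|c₁| ≤ 0.12 ≤ 0.123`). -/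
theorem su2_dim3_rect12Action_massGapS_1_5 {c₁ : ℝ} (hc : |c₁| ≤ 1 / 1800) :
    PerturbedMassGapAtS 3 2 ((1 / 5 : ℝ) / 4) (loopFamilyAction (d := 3) 2 (shapeLoop rect12Shape) fun _ => c₁) := by
  have hP : Fintype.card {p : Fin 3 × Fin 3 // p.1 < p.2} = 3 := by decide
  have hε : ∑ s : Rect12Idx 3, |c₁| * ((rect12Shape s).length : ℝ) ^ 2 ≤ 123 / 1000 := by
    rw [sum_rect12Shape_norm, hP]; push_cast; nlinarith [abs_nonneg c₁]
  exact su2_dim3_finiteShapes_massGapS_1_5 (c₀ := fun _ => c₁) (R := ((3 : ℕ) : ℝ)) length_rect12Shape_pos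
    (fun s => by exact_mod_cast norm_sub_le_rect12Shape s) hε

end Summit.Ventures.YMGap.RobustBall

end
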